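import Summits.CriticalPhenomena.PercolationContinuityZ3.Theorems.PercLowPointHalfSpaceQuantitativeBGNMirrorTwoGhost
import Summits.CriticalPhenomena.PercolationContinuityZ3.Theorems.PercLowPointHalfSpaceQuantitativeBGNMirrorTransfer
import Literature.Probability.Percolation.TwoGhostInequalityProofs
import HarnessLib

/-!
# `twoArm_half` — the p-uniform VOLUME TWO-ARM bound with exponent `λ = 1/2` on levels `u > 1/5`

Crux `Summit.CriticalPhenomena.PercolationContinuityZ3.Theses.PercMinContact.TwoArmWindow`
(item stmt-CriticalPhenomena-11499), line `registered` (`Cruxes/TwoArmWindow/Lines/birth.lean`, rev 2),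
helper of the lead (prover-line-stmt-CriticalPhenomena-11499-c2-0), `--supports stmt-CriticalPhenomena-11499`.

The line's OPEN stub `stub_volumeTwoArmCore` asks for the exponent `λ ≥ 3/5` in
`Σ_{y ∼ 0} P_u(|C(0)| ≥ n, |C(y)| ≥ n, 0 ↮ y) ≤ C · n^{-λ}`, uniformly in the level `1/5 < u < p_c(ℤ³)`.
This file lands the KNOWN half of it, the rigorous state of the art: **`λ = 1/2`**, uniformly in every
level `u > 1/5` (no sub-criticality needed), with the explicit constant `C = 6 · 396 · √5`:

`twoArm_half : ∃ C, ∀ u : unitInterval, 1/5 < u → ∀ n ≥ 1,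
  Σ_{y ∼ 0} P_u(|C(0)| ≥ n ∧ |C(y)| ≥ n ∧ 0 ↮ y) ≤ C · n^{-(1/2)}`.

Proof. For each of the six neighbours `y` of `0` the event lies, `P_u`-almost surely, in Hutchcroft's
two-cluster event `𝒮_{e,n}` at the edge `e = s(0, y)` (VERBATIM the event of
`Hutchcroft2020_twoGhost_corollary`, `d = 3`): `0 ↮ y` forces `e` closed; a cluster with at least `n`
vertices touches at least `n` lattice edges (`v ↦ s(v, v + e₀)` is injective,
`MirrorTwoGhost.encard_le_encard_edges_meeting`); and almost surely there is at most one infinite cluster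
(`Grimmett1999_numInfiniteClusters_le_one_holds`), so two infinite clusters at `0` and `y` would be joined
(`mem_openConn_of_numInfiniteClusters_le_one`) — hence one of them is finite.  The two-ghost inequality
(Hutchcroft 2020, Ann. Probab., arXiv:1808.08940 Cor. 1.7, PROVED in the tree as
`Hutchcroft2020_twoGhost_corollary_holds`) bounds each term by `66 · 6 · √((1-u)/(u n))`, and
`√((1-u)/(un)) ≤ √(1/u) · n^{-1/2} ≤ √5 · n^{-1/2}` for `u > 1/5` (`sqrt_ratio_le`).  Summing over the
`2 · 3 = 6` neighbours (`card_neighborFinset_zdGraph_holds`) gives the claim.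

What is deliberately NOT here: any exponent `λ > 1/2` (open: every published improvement, e.g.
Hutchcroft 2021 arXiv:2008.11197 §3, consumes an a-priori one-arm volume tail uniform in `u < p_c`,
which is conjunct-strength), and the levels `u ≤ 1/5` (the registered stub `stub_twoArmSmallLevel`,
exponent `1`, by path counting).
-/

noncomputable section

namespace Summit.CriticalPhenomena.PercolationContinuityZ3.Theorems

open MeasureTheory Literature.Probability.Percolation Literature.Probability.LatticeModels

namespace TwoArmWindowHalf

/-- **One neighbour, event inclusion (a.s.).** For `y ∼ 0` in `ℤ³`, every level `u` and every `n`,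
`P_u(|C(0)| ≥ n ∧ |C(y)| ≥ n ∧ 0 ↮ y) ≤ P_u(𝒮_{s(0,y),n})`, the right-hand event being verbatim that of
`Hutchcroft2020_twoGhost_corollary` (`d = 3`, `x = 0`): edge closed, clusters distinct, each touching at
least `n` lattice edges, one of them finite (a.s. uniqueness of the infinite cluster). -/
theorem real_twoArm_le_real_twoGhostEvent (u : unitInterval) (n : ℕ) (y : Site 3)
    (hy : (zdGraph 3).Adj 0 y) :
    (bondPercolation (zdGraph 3) u).real
        {ω | (n : ℕ∞) ≤ (openCluster ω 0).encard ∧ (n : ℕ∞) ≤ (openCluster ω y).encard ∧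
          ¬ (openGraph ω).Reachable 0 y} ≤
      (bondPercolation (zdGraph 3) u).real
        {ω | s((0 : Site 3), y) ∉ ω ∧ ¬ (openGraph ω).Reachable (0 : Site 3) y ∧
          (n : ℕ∞) ≤ {e ∈ (zdGraph 3).edgeSet | ∃ v ∈ e, v ∈ openCluster ω (0 : Site 3)}.encard ∧
          (n : ℕ∞) ≤ {e ∈ (zdGraph 3).edgeSet | ∃ v ∈ e, v ∈ openCluster ω y}.encard ∧
          ((openCluster ω (0 : Site 3)).Finite ∨ (openCluster ω y).Finite)} := by
  have h0y : (0 : Site 3) ≠ y := hy.ne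
  refine ENNReal.toReal_mono (measure_ne_top _ _) (measure_mono_ae ?_)
  filter_upwards [Grimmett1999_numInfiniteClusters_le_one_holds 3 u] with ω hN
  rintro ⟨h0 : (n : ℕ∞) ≤ _, hY : (n : ℕ∞) ≤ _, hdis : ¬ _⟩
  refine ⟨fun he => hdis ((openGraph_adj ω _ _).2 ⟨he, h0y⟩).reachable, hdis,
    le_trans h0 (MirrorTwoGhost.encard_le_encard_edges_meeting 0 subset_rfl),
    le_trans hY (MirrorTwoGhost.encard_le_encard_edges_meeting 0 subset_rfl), ?_⟩
  by_contra h
  obtain ⟨h0inf, hyinf⟩ := not_or.1 h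
  exact hdis (mem_openConn_of_numInfiniteClusters_le_one (x := (0 : Site 3)) (y := y) hN h0inf hyinf)

/-- **One neighbour, the two-ghost bound at a level `u > 1/5`**: for `y ∼ 0`, `n ≥ 1`,
`P_u(|C(0)| ≥ n ∧ |C(y)| ≥ n ∧ 0 ↮ y) ≤ 396 · √5 · n^{-1/2}` (Hutchcroft 2020 Cor. 1.7 with degree
`2 · 3`, then `√((1-u)/(un)) ≤ √(1/u) n^{-1/2}` and `1/u < 5`). [cite: Hutchcroft2020Locality, Corollary 1.7] -/
theorem real_twoArm_le_of_adj (u : unitInterval) (hu : 1 / 5 < (u : ℝ)) (n : ℕ) (hn : 1 ≤ n)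
    (y : Site 3) (hy : (zdGraph 3).Adj 0 y) :
    (bondPercolation (zdGraph 3) u).real
        {ω | (n : ℕ∞) ≤ (openCluster ω 0).encard ∧ (n : ℕ∞) ≤ (openCluster ω y).encard ∧
          ¬ (openGraph ω).Reachable 0 y} ≤
      396 * Real.sqrt 5 * (n : ℝ) ^ (-(1 / 2 : ℝ)) := by
  have hu0 : 0 < (u : ℝ) := lt_trans (by norm_num) hu
  have htg := Hutchcroft2020_twoGhost_corollary_holds 3 (by norm_num) u hu0 n hn 0 y hy
  have hsq : Real.sqrt ((1 - (u : ℝ)) / ((u : ℝ) * n)) ≤ Real.sqrt 5 * (n : ℝ) ^ (-(1 / 2 : ℝ)) := by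
    refine (QuantitativeBGNMirrorTransfer.sqrt_ratio_le (u : ℝ) hu0 n hn).trans ?_
    refine mul_le_mul_of_nonneg_right (Real.sqrt_le_sqrt ?_) (Real.rpow_nonneg (Nat.cast_nonneg n) _)
    rw [div_le_iff₀ hu0]
    linarith
  calc _ ≤ _ := real_twoArm_le_real_twoGhostEvent u n y hy
    _ ≤ 66 * (2 * (3 : ℝ)) * Real.sqrt ((1 - (u : ℝ)) / ((u : ℝ) * n)) := htg
    _ ≤ 66 * (2 * (3 : ℝ)) * (Real.sqrt 5 * (n : ℝ) ^ (-(1 / 2 : ℝ))) :=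
        mul_le_mul_of_nonneg_left hsq (by norm_num)
    _ = 396 * Real.sqrt 5 * (n : ℝ) ^ (-(1 / 2 : ℝ)) := by ring

end TwoArmWindowHalf

open TwoArmWindowHalf in
/-- **`twoArm_half` — the KNOWN half (`λ = 1/2`) of the line's open stub `stub_volumeTwoArmCore`.**
There is `C` (namely `6 · 396 · √5`) such that for every level `u > 1/5` and every `n ≥ 1`,
`Σ_{y ∼ 0} P_u(|C(0)| ≥ n ∧ |C(y)| ≥ n ∧ 0 ↮ y) ≤ C · n^{-1/2}`: Hutchcroft's two-ghost inequality
(arXiv:1808.08940 Cor. 1.7, `Hutchcroft2020_twoGhost_corollary_holds`) at each of the `6` edges at the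
origin, a.s. uniqueness of the infinite cluster supplying "one of the two clusters is finite".  The open
stub asks for the same with an exponent `λ ≥ 3/5` (restricted to `u < p_c`). -/
theorem twoArm_half :
    ∃ C : ℝ, ∀ u : unitInterval, 1 / 5 < (u : ℝ) → ∀ n : ℕ, 1 ≤ n →
      ∑ y ∈ (zdGraph 3).neighborFinset (0 : Site 3),
        (bondPercolation (zdGraph 3) u).real
          {ω | (n : ℕ∞) ≤ (openCluster ω 0).encard ∧ (n : ℕ∞) ≤ (openCluster ω y).encard ∧
            ¬ (openGraph ω).Reachable 0 y} ≤ C * (n : ℝ) ^ (-(1 / 2 : ℝ)) := by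
  refine ⟨6 * (396 * Real.sqrt 5), fun u hu n hn => ?_⟩
  calc _ ≤ ∑ _y ∈ (zdGraph 3).neighborFinset (0 : Site 3), 396 * Real.sqrt 5 * (n : ℝ) ^ (-(1 / 2 : ℝ)) :=
        Finset.sum_le_sum fun y hy =>
          real_twoArm_le_of_adj u hu n hn y ((SimpleGraph.mem_neighborFinset _ _ _).1 hy)
    _ = 6 * (396 * Real.sqrt 5) * (n : ℝ) ^ (-(1 / 2 : ℝ)) := by
        rw [Finset.sum_const, card_neighborFinset_zdGraph_holds (0 : Site 3), nsmul_eq_mul]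
        push_cast
        ring

end Summit.CriticalPhenomena.PercolationContinuityZ3.Theorems

end
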